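import Summits.HubbardSuperconductivity.HubbardSuperconductivity.Theorems.AnisotropyChordTransferFibre3FinXDCheck

/-!
# Route `AnisotropyChord` / H0 rotor rung: FIN per-`L` row-D (KT-2a″) SUB-CELL facts, `L = 10` (6–11)

Row-D facts `xdCellAny0 10 (49/50) la lb aD = true` on quarter sub-cells of the combined cells whose side condition needs `aD ≈ .04` (mechhunt STATUS p3 g7 REPORT 3).
Prover seat `hubbard-h0-rotor-p3` g7; helper for piece A = stmt-HubbardSuperconductivity-23918 of rung 19089 (`--supports`, helper class).
WHAT THIS IS NOT: nothing here proves superconductivity in the Hubbard model (rotor TARGET as worded stays FALSE, g15 verdict); kernel facts /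
assembly for ONE conditional reduction at one `L`.  No sorry.
-/

set_option linter.dupNamespace false
set_option autoImplicit false

namespace Summit.HubbardSuperconductivity.HubbardSuperconductivity.Theorems.AnisotropyChord.Transfer.Fibre3

namespace FinXD

/-- row-D sub-cell `[14399442926201325, 14488328376363062]` of `L = 10`. [folklore] -/
theorem xd10s_130_2 : xdCellAny0 10 (49/50 : ℚ) 14399442926201325 14488328376363062 (1/25 : ℚ) = true := by decide +kernel

/-- row-D sub-cell `[14488328376363062, 14577213826524799]` of `L = 10`. [folklore] -/
theorem xd10s_130_3 : xdCellAny0 10 (49/50 : ℚ) 14488328376363062 14577213826524799 (1/25 : ℚ) = true := by decide +kernel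

/-- row-D sub-cell `[14577213826524799, 14668321412940579]` of `L = 10`. [folklore] -/
theorem xd10s_131_0 : xdCellAny0 10 (49/50 : ℚ) 14577213826524799 14668321412940579 (1/25 : ℚ) = true := by decide +kernel

/-- row-D sub-cell `[14668321412940579, 14759428999356359]` of `L = 10`. [folklore] -/
theorem xd10s_131_1 : xdCellAny0 10 (49/50 : ℚ) 14668321412940579 14759428999356359 (1/25 : ℚ) = true := by decide +kernel

/-- row-D sub-cell `[14759428999356359, 14850536585772139]` of `L = 10`. [folklore] -/
theorem xd10s_131_2 : xdCellAny0 10 (49/50 : ℚ) 14759428999356359 14850536585772139 (1/25 : ℚ) = true := by decide +kernel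

/-- row-D sub-cell `[14850536585772139, 14941644172187919]` of `L = 10`. [folklore] -/
theorem xd10s_131_3 : xdCellAny0 10 (49/50 : ℚ) 14850536585772139 14941644172187919 (1/25 : ℚ) = true := by decide +kernel

end FinXD

end Summit.HubbardSuperconductivity.HubbardSuperconductivity.Theorems.AnisotropyChord.Transfer.Fibre3
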